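import Summits.AtomisticToContinuum.Crystallization.Theorems.FrustratedLawDichotomyAtlasReach
import Summits.AtomisticToContinuum.Crystallization.Theorems.FrustratedLawDichotomyFarFieldSharp
import Summits.AtomisticToContinuum.Crystallization.Theorems.FrustratedLawDichotomyPeriodicEnergyCeilingKernel

/-!
# FrustratedLawDichotomy · crux `AperiodicFrustratedLawGap` (stmt-AtomisticToContinuum-27623) — THE SHARP DEFICIT CAP (leaf ℓ2 of the atlas reach)
# (decomp-a2c, lens-5 «finite/base range + asymptotic regime + bridge», generation 116)

The reach theorem (404) `…AtlasReach.coherentMassExclusion_of_floors` turns certified row floors with margins `≥ m > 0` plus a deterministic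
DEFICIT CAP `hcap : ∀ μ, IsRootedHardCore (7/10) μ → e⋆ − rootEnergy V_LJ μ ≤ D` into F(η) «no admissible minimising law is `(1−η)`-coherent with
the atlas» for every `η ≤ reach m D = m/(m+D)`; the tree's cap is `D_univ = (250/12)(10/7)⁶ − 1/24 ≈ 177.04`.  This file proves ★ `D = 5` in the
exact `hcap` shape (`deficit_le_five`) and plugs it in BY NAME (`coherentMassExclusion_sharp`): `reach(m_A(F1) = 5057/10⁶, 5) > 1/1000 > 35·reach(·, D_univ)`
(`reach_F1_sharp`).  THE ESTIMATE — naive ball counting Abel-summed against the exact lower envelope of `V_LJ`; no Kepler density, no Literature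
fact, no new lemma family — is ★ `rootEnergy V_LJ μ ≥ −139/25 = −5.56` on every rooted `7/10`-hard-core configuration (`rootEnergy_ge`):
* §1 envelope: `−V ≤ 1/12` everywhere, `−V` antitone on `[1, ∞)`; §2 a majorant `capW z ≥ (−V(‖z‖))⁺`: the NEAR FIELD `7/10 ≤ ‖z‖ < 14/5` is cut
  into 15 shells `⌊‖z‖/(7/50)⌋ = b ∈ [5, 20)` with weight `shellW b = sup_{r ≥ 7b/50} (−V(r))⁺` (`1/12` for `b ≤ 7`, `−V(7b/50)` for `b ≥ 8`); the
  FAR FIELD `‖z‖ ≥ 14/5` gets `‖z‖⁻⁶/6`;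
* §3 DISCRETE LAYER CAKE (Abel summation against CUMULATIVE counts `#{z : b z ≤ b} ≤ shellG b`, the literal packing bound of the route-own
  `…FarFieldSharp.card_le_of_separated_shell_three` on the shell `[7/10, 7(b+1)/50]` around the root): near field `≤ nearCap ≤ 1077/100` (15 terms,
  `norm_num`); far field by the route-own sharp sum `…FarFieldSharp.sum_inv_pow_le_of_separated_sharp` (`k = 3`, `R = 14/5`): `≤ (1/6)(21/10)`;
* §4 every finite `7/10`-separated `T ∋ 0` has `Σ_{z ∈ T∖0} (−V(‖z‖))⁺ ≤ 278/25` (`sum_capW_le`), hence `∫⁻ (V_LJ)⁻ d(count|S) ≤ 278/25`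
  (`lintegral_neg_le`, supremum over finite sums) and, through the route-own parts formula `…TransportPriceLocal.rootEnergy_eq_parts`,
  `rootEnergy ≥ −139/25`; §5 with the tree's `e⋆ ≤ −7175/10⁴` (`…PeriodicEnergyCeilingKernel.eStar_le`) the deficit is `≤ 5.56 − 0.7175 ≤ 5`, with the
  periodised dimer alone (`…PhaseGap.eStar_le_neg : e⋆ ≤ −1/24`, in (404)'s own cone) the same two lines give `≤ 6`; `aperiodicFrustratedLawGap_of_offAtlasMassGap_sharp`: crux ⟸ hfloor lines ∧ A(reach m 5).
HONEST LABEL: a pointwise (configuration-level) cap; the continuum limit of this counting is `≈ 4.4`, a certified one-centre optimum would give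
`D♯ ≈ 1` — (404)'s dial `reach_anti` takes either by name.  Imports: TREE (404) `…AtlasReach` (ED2) and the route-own `…FarFieldSharp`,
`…PeriodicEnergyCeilingKernel` only; 4 plain `def`s (`shellW shellG capW nearCap`); no instance / notation / option; 0 sorry.
-/
noncomputable section

namespace Summit.AtomisticToContinuum.Crystallization.Theorems.FrustratedLawDichotomySharpDeficitCap

open MeasureTheory Metric Set
open scoped ENNReal BigOperators
open Literature.MathematicalPhysics.StatisticalMechanics Literature.Probability.Process
open Literature.Probability.Process.LocalConfig (finite_inter_of_separated)
open Summit.AtomisticToContinuum.Crystallization.Theorems.ChargedEnergyGapNegative (E3 eStar)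
open Summit.AtomisticToContinuum.Crystallization.Theorems.FrustratedLawDichotomyTransportPriceLocal (rootEnergy_eq_parts)
open Summit.AtomisticToContinuum.Crystallization.Theorems.FrustratedLawDichotomyFarFieldSharp (card_le_of_separated_shell_three sum_inv_pow_le_of_separated_sharp)
open Summit.AtomisticToContinuum.Crystallization.Theorems.FrustratedLawDichotomyAtlasReach (reach Duniv CoherentMassExclusion OffAtlasMassGap coherentMassExclusion_of_floors aperiodicFrustratedLawGap_of_massSplit)
open Summit.AtomisticToContinuum.Crystallization.Theorems.FrustratedLawDichotomyPeriodicEnergyCeilingKernel (eStar_le)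

/-! ## §1. The exact lower envelope of `V_LJ` -/
/-- `−V_LJ ≤ 1/12` everywhere (Literature `neg_one_div_le_lennardJones`). [folklore] -/
theorem neg_lennardJones_le (r : ℝ) : -lennardJones r ≤ 1 / 12 := by
  have := neg_one_div_le_lennardJones r
  linarith

/-- `−V_LJ` is antitone on `[1, ∞)` (`−V = (2u − u²)/12` in `u = r⁻⁶ ∈ (0, 1]`). [folklore] -/
theorem neg_lennardJones_anti {a r : ℝ} (ha : 1 ≤ a) (har : a ≤ r) : -lennardJones r ≤ -lennardJones a := by
  have ha0 : 0 < a := by linarith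
  have hr0 : 0 < r := by linarith
  have hv1 : a⁻¹ ^ 6 ≤ 1 := pow_le_one₀ (by positivity) (inv_le_one_of_one_le₀ ha)
  have huv : r⁻¹ ^ 6 ≤ a⁻¹ ^ 6 := pow_le_pow_left₀ (by positivity) ((inv_le_inv₀ hr0 ha0).2 har) 6
  have hu0 : 0 ≤ r⁻¹ ^ 6 := by positivity
  have e : ∀ x : ℝ, x⁻¹ ^ 12 = x⁻¹ ^ 6 * x⁻¹ ^ 6 := fun x => by ring
  unfold lennardJones
  rw [e, e]
  nlinarith [mul_nonneg (sub_nonneg.2 huv) (show (0 : ℝ) ≤ 2 - r⁻¹ ^ 6 - a⁻¹ ^ 6 by linarith)]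

/-! ## §2. The shell majorant: width `7/50`, near field `[7/10, 14/5)`, far field `[14/5, ∞)` -/
/-- weight of shell `b` (`⌊r/(7/50)⌋ = b`): `sup_{r ≥ 7b/50} (−V_LJ(r))⁺` = `1/12` for `b ≤ 7` (`7b/50 ≤ 1`), `−V_LJ(7b/50)` for `b ≥ 8`. [new: bookkeeping] -/
def shellW (b : ℕ) : ℝ := if b ≤ 7 then 1 / 12 else -lennardJones ((b : ℝ) * (7 / 50))

/-- cumulative packing count `#{z ∈ T∖0 : ‖z‖ ≤ 7(b+1)/50} ≤ shellG b = (2·(7(b+1)/50)/(7/10) + 1)³ − 1` (the literal right-hand side of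
`…FarFieldSharp.card_le_of_separated_shell_three` on the shell `[7/10, 7(b+1)/50]`). [new: bookkeeping] -/
def shellG (b : ℕ) : ℝ := (2 * (((b : ℝ) + 1) * (7 / 50)) / (7 / 10) + 1) ^ 3 - (2 * (7 / 10 : ℝ) / (7 / 10) - 1) ^ 3

/-- the weights decrease. [new: bookkeeping] -/
theorem shellW_succ_le (b : ℕ) : shellW (b + 1) ≤ shellW b := by
  unfold shellW
  by_cases h1 : b + 1 ≤ 7
  · rw [if_pos h1, if_pos (by omega)]
  · rw [if_neg h1]
    by_cases h0 : b ≤ 7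
    · rw [if_pos h0]
      exact neg_lennardJones_le _
    · rw [if_neg h0]
      have hb : (8 : ℝ) ≤ b := by exact_mod_cast (show 8 ≤ b by omega)
      push_cast
      exact neg_lennardJones_anti (by linarith) (by linarith)

/-- the weights are non-negative. [new: bookkeeping] -/
theorem shellW_nonneg (b : ℕ) : 0 ≤ shellW b := by
  unfold shellW
  split_ifs with h
  · norm_num
  · have hb : (8 : ℝ) ≤ b := by exact_mod_cast (show 8 ≤ b by omega)
    have := lennardJones_nonpos (show (1 : ℝ) ≤ (b : ℝ) * (7 / 50) by linarith)
    linarith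

/-- pointwise: `−V_LJ(r) ≤ shellW ⌊r/(7/50)⌋` for `r ≥ 0`. [new: bookkeeping] -/
theorem neg_lennardJones_le_shellW {r : ℝ} (hr : 0 ≤ r) : -lennardJones r ≤ shellW ⌊r / (7 / 50)⌋₊ := by
  have hfl : (⌊r / (7 / 50)⌋₊ : ℝ) * (7 / 50) ≤ r := by
    have h := Nat.floor_le (show 0 ≤ r / (7 / 50) by positivity)
    rwa [le_div_iff₀ (by norm_num : (0 : ℝ) < 7 / 50)] at h
  unfold shellW
  split_ifs with h
  · exact neg_lennardJones_le r
  · have hb : (8 : ℝ) ≤ ⌊r / (7 / 50)⌋₊ := by exact_mod_cast (show 8 ≤ ⌊r / (7 / 50)⌋₊ by omega)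
    exact neg_lennardJones_anti (by linarith) hfl

/-- the majorant of `(−V_LJ(‖z‖))⁺`: the shell weight in the near field, `‖z‖⁻⁶/6` in the far field. [new: bookkeeping] -/
def capW (z : E3) : ℝ := if ‖z‖ < 14 / 5 then shellW ⌊‖z‖ / (7 / 50)⌋₊ else 1 / 6 * ‖z‖⁻¹ ^ 6

/-- `(−V_LJ(‖z‖))⁺ ≤ capW z`. [new: bookkeeping] -/
theorem capW_spec (z : E3) : -lennardJones ‖z‖ ≤ capW z ∧ 0 ≤ capW z := by
  unfold capW; split_ifs with h
  · exact ⟨neg_lennardJones_le_shellW (norm_nonneg z), shellW_nonneg _⟩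
  · have : 0 ≤ (1 / 12) * ‖z‖⁻¹ ^ 12 := by positivity
    refine ⟨?_, by positivity⟩
    unfold lennardJones
    linarith

/-! ## §3. Cumulative counting, Abel-summed: the discrete layer cake -/
/-- **DISCRETE LAYER CAKE.**  Indices `g x ∈ [b₀, B)` on a finite set `s`, weights `ν` antitone with `ν B ≥ 0`, cumulative counts
`#{x : g x ≤ b} ≤ G b` (`b₀ ≤ b < B`) and `#s ≤ C`: then `Σ_{x ∈ s} ν (g x) ≤ Σ_{b₀ ≤ b < B} G b·(ν b − ν (b+1)) + C·ν B`. [folklore] -/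
theorem sum_le_layerCake {ι : Type*} (s : Finset ι) (g : ι → ℕ) (ν G : ℕ → ℝ) {b₀ B : ℕ} {C : ℝ}
    (hg : ∀ x ∈ s, b₀ ≤ g x ∧ g x < B) (hν : ∀ b, ν (b + 1) ≤ ν b) (hνB : 0 ≤ ν B)
    (hG : ∀ b, b₀ ≤ b → b < B → ((s.filter fun x => g x ≤ b).card : ℝ) ≤ G b) (hC : (s.card : ℝ) ≤ C) :
    ∑ x ∈ s, ν (g x) ≤ ∑ b ∈ Finset.Ico b₀ B, G b * (ν b - ν (b + 1)) + C * ν B := by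
  classical
  have htel : ∀ a n : ℕ, ∑ k ∈ Finset.range n, (ν (a + k) - ν (a + k + 1)) = ν a - ν (a + n) := fun a n => by
    induction n with
    | zero => simp
    | succ n ih => rw [Finset.sum_range_succ, ih, show a + (n + 1) = a + n + 1 from rfl]; ring
  -- `ν a` as a sum of the non-negative drops above `a`, plus `ν B`
  have tel : ∀ a, b₀ ≤ a → a ≤ B → ν a = ∑ b ∈ Finset.Ico b₀ B, (if a ≤ b then ν b - ν (b + 1) else 0) + ν B := by
    intro a h0 hB
    rw [← Finset.sum_filter]
    have hf : (Finset.Ico b₀ B).filter (fun b => a ≤ b) = Finset.Ico a B := by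
      ext b; simp only [Finset.mem_filter, Finset.mem_Ico]; omega
    rw [hf, Finset.sum_Ico_eq_sum_range, htel, Nat.add_sub_cancel' hB]
    ring
  have hrow : ∀ b ∈ Finset.Ico b₀ B, ∑ x ∈ s, (if g x ≤ b then ν b - ν (b + 1) else 0) ≤ G b * (ν b - ν (b + 1)) := by
    intro b hb
    rw [← Finset.sum_filter, Finset.sum_const, nsmul_eq_mul]
    exact mul_le_mul_of_nonneg_right (hG b (Finset.mem_Ico.1 hb).1 (Finset.mem_Ico.1 hb).2) (sub_nonneg.2 (hν b))
  calc ∑ x ∈ s, ν (g x)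
      = ∑ x ∈ s, (∑ b ∈ Finset.Ico b₀ B, (if g x ≤ b then ν b - ν (b + 1) else 0) + ν B) :=
        Finset.sum_congr rfl fun x hx => tel (g x) (hg x hx).1 (hg x hx).2.le
    _ = ∑ b ∈ Finset.Ico b₀ B, ∑ x ∈ s, (if g x ≤ b then ν b - ν (b + 1) else 0) + s.card * ν B := by
        rw [Finset.sum_add_distrib, Finset.sum_comm, Finset.sum_const, nsmul_eq_mul]
    _ ≤ ∑ b ∈ Finset.Ico b₀ B, G b * (ν b - ν (b + 1)) + C * ν B :=
        add_le_add (Finset.sum_le_sum hrow) (mul_le_mul_of_nonneg_right hC hνB)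

/-- the near-field constant: the layer cake of the shell weights against the cumulative packing counts. [new: bookkeeping] -/
def nearCap : ℝ := ∑ b ∈ Finset.Ico 5 20, shellG b * (shellW b - shellW (b + 1)) + shellG 19 * shellW 20

/-- ★ THE NUMBER: `nearCap ≤ 1077/100` (fifteen explicit terms). [new: numerical instance] -/
theorem nearCap_le : nearCap ≤ 1077 / 100 := by
  unfold nearCap
  rw [Finset.sum_Ico_eq_sum_range]
  simp only [Finset.sum_range_succ, Finset.sum_range_zero]
  norm_num [shellG, shellW, lennardJones]

/-! ## §4. The finite core and the negative part of the root energy -/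
/-- ★ **THE FINITE CORE.**  For a finite `7/10`-separated `T ∋ 0`: `Σ_{z ∈ T∖0} capW z ≤ 1077/100 + 7/20 = 278/25`. [new: junction] -/
theorem sum_capW_le (T : Finset E3) (hsep : ∀ x ∈ T, ∀ y ∈ T, x ≠ y → (7 : ℝ) / 10 ≤ dist x y) (h0 : (0 : E3) ∈ T) :
    ∑ z ∈ T.erase 0, capW z ≤ 278 / 25 := by
  classical
  have hdist : ∀ z ∈ T.erase 0, (7 : ℝ) / 10 ≤ ‖z‖ := fun z hz => by
    have h := hsep z (Finset.mem_of_mem_erase hz) 0 h0 (Finset.ne_of_mem_erase hz)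
    rwa [dist_zero_right] at h
  have hsep' : ∀ U : Finset E3, U ⊆ T.erase 0 → ∀ x ∈ U, ∀ y ∈ U, x ≠ y → (7 : ℝ) / 10 ≤ dist x y :=
    fun U hU x hx y hy hxy => hsep x (Finset.mem_of_mem_erase (hU hx)) y (Finset.mem_of_mem_erase (hU hy)) hxy
  set near := (T.erase 0).filter (fun z => ‖z‖ < 14 / 5) with hnear
  set far := (T.erase 0).filter (fun z => ¬‖z‖ < 14 / 5) with hfar
  have hnearT : near ⊆ T.erase 0 := Finset.filter_subset _ _
  have hfarT : far ⊆ T.erase 0 := Finset.filter_subset _ _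
  have hsplit : ∑ z ∈ T.erase 0, capW z = ∑ z ∈ near, shellW ⌊‖z‖ / (7 / 50)⌋₊ + ∑ z ∈ far, 1 / 6 * ‖z‖⁻¹ ^ 6 := by
    rw [← Finset.sum_filter_add_sum_filter_not (T.erase 0) (fun z => ‖z‖ < 14 / 5)]
    congr 1
    · exact Finset.sum_congr rfl fun z hz => by rw [capW, if_pos (Finset.mem_filter.1 hz).2]
    · exact Finset.sum_congr rfl fun z hz => by rw [capW, if_neg (Finset.mem_filter.1 hz).2]
  -- NEAR FIELD: the layer cake against the cumulative shell packing counts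
  have hnear_le : ∑ z ∈ near, shellW ⌊‖z‖ / (7 / 50)⌋₊ ≤ nearCap := by
    refine sum_le_layerCake near (fun z => ⌊‖z‖ / (7 / 50)⌋₊) shellW shellG (fun z hz => ?_) shellW_succ_le
      (shellW_nonneg 20) (fun b hb0 hbB => ?_) ?_
    · obtain ⟨hzT, hzn⟩ := Finset.mem_filter.1 hz
      refine ⟨Nat.le_floor ?_, (Nat.floor_lt (by positivity)).2 ?_⟩
      · rw [le_div_iff₀ (by norm_num)]
        linarith [hdist z hzT]
      · rw [div_lt_iff₀ (by norm_num)]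
        linarith
    · have hb : (5 : ℝ) ≤ b := by exact_mod_cast hb0
      refine card_le_of_separated_shell_three _ 0 (by norm_num) (by norm_num) (by linarith)
        (hsep' _ ((Finset.filter_subset _ _).trans hnearT)) fun a ha => ?_
      obtain ⟨ha1, ha2⟩ := Finset.mem_filter.1 ha
      rw [dist_zero_right]
      refine ⟨hdist a (hnearT ha1), ?_⟩
      have h1 := Nat.lt_floor_add_one (‖a‖ / (7 / 50))
      have h2 : ((⌊‖a‖ / (7 / 50)⌋₊ : ℕ) : ℝ) ≤ b := by exact_mod_cast ha2
      rw [div_lt_iff₀ (by norm_num)] at h1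
      nlinarith
    · have h := card_le_of_separated_shell_three near 0 (δ := 7 / 10) (R := 7 / 10) (D := 14 / 5) (by norm_num) (by norm_num)
        (by norm_num) (hsep' _ hnearT) fun a ha => by
          obtain ⟨haT, han⟩ := Finset.mem_filter.1 ha
          rw [dist_zero_right]
          exact ⟨hdist a haT, han.le⟩
      refine h.trans (le_of_eq ?_)
      norm_num [shellG]
  -- FAR FIELD: the sharp inverse-power sum of the route, `k = 3`, `R = 14/5`
  have hfar_le : ∑ z ∈ far, 1 / 6 * ‖z‖⁻¹ ^ 6 ≤ 7 / 20 := by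
    have h := sum_inv_pow_le_of_separated_sharp far 0 (k := 3) (by norm_num) (by norm_num : (0 : ℝ) < 7 / 10)
      (by norm_num : (7 / 10 : ℝ) / 2 ≤ 14 / 5) (hsep' _ hfarT) fun a ha => by
        rw [dist_zero_right]
        exact not_lt.1 (Finset.mem_filter.1 ha).2
    have e : ∑ z ∈ far, 1 / 6 * ‖z‖⁻¹ ^ 6 = 1 / 6 * ∑ z ∈ far, (dist z 0)⁻¹ ^ (3 + 3) := by
      rw [Finset.mul_sum]
      exact Finset.sum_congr rfl fun z _ => by rw [dist_zero_right]
    rw [e]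
    have hnum : 3 / ((3 : ℕ) : ℝ) * (2 / (7 / 10 : ℝ)) ^ 3 * (14 / 5 : ℝ)⁻¹ ^ 3 +
        6 * (((3 : ℕ) : ℝ) + 2) / (((3 : ℕ) : ℝ) + 1) * (2 / (7 / 10 : ℝ)) ^ 2 * (14 / 5 : ℝ)⁻¹ ^ (3 + 1) +
        3 / (((3 : ℕ) : ℝ) + 2) * (2 / (7 / 10 : ℝ)) * (14 / 5 : ℝ)⁻¹ ^ (3 + 2) + 2 * (14 / 5 : ℝ)⁻¹ ^ (3 + 3) ≤ 21 / 10 := by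
      norm_num
    linarith
  rw [hsplit]
  linarith [nearCap_le]

/-- ★ **NEGATIVE PART OF THE ROOT ENERGY**: `∫⁻ (V_LJ(‖z‖))⁻ d(count|S) ≤ 278/25` for a `7/10`-separated `S ∋ 0`. [new: junction] -/
theorem lintegral_neg_le {S : Set E3} (hsep : ∀ x ∈ S, ∀ y ∈ S, x ≠ y → (7 : ℝ) / 10 ≤ dist x y) (h0 : (0 : E3) ∈ S) :
    ∫⁻ z, ENNReal.ofReal (-lennardJones ‖z‖) ∂((Measure.count : Measure E3).restrict S) ≤ ENNReal.ofReal (278 / 25) := by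
  classical
  -- `S` is countable: compact balls meet it finitely (Literature `finite_inter_of_separated`)
  have hS : S.Countable := by
    have e : S = ⋃ n : ℕ, closedBall (0 : E3) n ∩ S := by
      ext x
      simp only [mem_iUnion, mem_inter_iff, mem_closedBall, dist_zero_right]
      exact ⟨fun hx => ⟨⌈‖x‖⌉₊, Nat.le_ceil _, hx⟩, fun ⟨n, _, hx⟩ => hx⟩
    rw [e]
    exact countable_iUnion fun n => (finite_inter_of_separated (by norm_num : (0 : ℝ) < 7 / 10) hsep (isCompact_closedBall _ _)).countable
  rw [lintegral_countable _ hS, ENNReal.tsum_eq_iSup_sum]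
  refine iSup_le fun T' => ?_
  set T : Finset E3 := insert 0 (T'.map (Function.Embedding.subtype (· ∈ S))) with hTdef
  have hTS : ∀ z ∈ T, z ∈ S := fun z hz => by
    rcases Finset.mem_insert.1 hz with rfl | hz
    · exact h0
    · obtain ⟨w, -, rfl⟩ := Finset.mem_map.1 hz; exact w.2
  have h0T : (0 : E3) ∈ T := Finset.mem_insert_self _ _
  have hsepT : ∀ x ∈ T, ∀ y ∈ T, x ≠ y → (7 : ℝ) / 10 ≤ dist x y := fun x hx y hy hxy => hsep x (hTS x hx) y (hTS y hy) hxy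
  calc ∑ z ∈ T', ENNReal.ofReal (-lennardJones ‖(z : E3)‖) * (Measure.count : Measure E3) {(z : E3)}
      = ∑ z ∈ T', ENNReal.ofReal (-lennardJones ‖(z : E3)‖) := Finset.sum_congr rfl fun z _ => by
        rw [Measure.count_singleton, mul_one]
    _ = ∑ z ∈ T'.map (Function.Embedding.subtype (· ∈ S)), ENNReal.ofReal (-lennardJones ‖z‖) := by rw [Finset.sum_map]; rfl
    _ ≤ ∑ z ∈ T, ENNReal.ofReal (-lennardJones ‖z‖) := Finset.sum_le_sum_of_subset (Finset.subset_insert _ _)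
    _ = ∑ z ∈ T.erase 0, ENNReal.ofReal (-lennardJones ‖z‖) := by
        rw [← Finset.add_sum_erase T _ h0T, norm_zero, lennardJones_zero, neg_zero, ENNReal.ofReal_zero, zero_add]
    _ ≤ ∑ z ∈ T.erase 0, ENNReal.ofReal (capW z) :=
        Finset.sum_le_sum fun z _ => ENNReal.ofReal_le_ofReal (capW_spec z).1
    _ = ENNReal.ofReal (∑ z ∈ T.erase 0, capW z) := (ENNReal.ofReal_sum_of_nonneg fun z _ => (capW_spec z).2).symm
    _ ≤ ENNReal.ofReal (278 / 25) := ENNReal.ofReal_le_ofReal (sum_capW_le T hsepT h0T)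

/-! ## §5. The sharp deficit cap and its plug into the reach theorem (404) -/
/-- ★★ **ROOT-ENERGY FLOOR AT HARD CORE `7/10`**: `rootEnergy V_LJ μ ≥ −139/25 = −5.56` (the tree's floor: `−(250/12)(10/7)⁶ ≈ −177.08`). [new: junction] -/
theorem rootEnergy_ge (μ : Measure E3) (hμ : IsRootedHardCore (7 / 10) μ) : -(139 / 25 : ℝ) ≤ rootEnergy lennardJones μ := by
  obtain ⟨S, h0, hsep, rfl⟩ := hμ
  obtain ⟨-, -, heq⟩ := rootEnergy_eq_parts (by norm_num : (0 : ℝ) < 7 / 10)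
    (show IsRootedHardCore (7 / 10) ((Measure.count : Measure E3).restrict S) from ⟨S, h0, hsep, rfl⟩)
  rw [heq]
  have hm : (∫⁻ z, ENNReal.ofReal (-lennardJones ‖z‖) ∂((Measure.count : Measure E3).restrict S)).toReal ≤ 278 / 25 :=
    ENNReal.toReal_le_of_le_ofReal (by norm_num) (lintegral_neg_le hsep h0)
  have hp : 0 ≤ (∫⁻ z, ENNReal.ofReal (lennardJones ‖z‖) ∂((Measure.count : Measure E3).restrict S)).toReal :=
    ENNReal.toReal_nonneg
  linarith

/-- ★★ **THE SHARP DEFICIT CAP** (leaf ℓ2 = the `hcap` of (404) verbatim, `D = 5`): `e⋆ − rootEnergy V_LJ μ ≤ 5` on every rooted `7/10`-hard-core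
configuration (`−139/25 ≤ rootEnergy`, `e⋆ ≤ −7175/10⁴`). [new: junction] -/
theorem deficit_le_five (μ : Measure E3) (hμ : IsRootedHardCore (7 / 10) μ) : eStar - rootEnergy lennardJones μ ≤ 5 := by
  have h2 : eStar ≤ -(7175 / 10000) := eStar_le
  linarith [rootEnergy_ge μ hμ]

/-- ★★ **THE PLUG (by name).**  Certified row floors with margins `≥ m > 0` ALONE exclude every admissible minimising law that is
`(1 − m/(m+5))`-coherent with the atlas: (404) `coherentMassExclusion_of_floors` with `hcap := deficit_le_five`. [new: junction] -/
theorem coherentMassExclusion_sharp (n : ℕ) (K : ℕ → Set (MeasureTheory.Measure (EuclideanSpace ℝ (Fin 3)))) (hK : ∀ i, MeasurableSet (K i))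
    (mK : ℕ → ℝ)
    (hfloor : ∀ i < n, ∀ μ : Measure E3, IsRootedHardCore (7 / 10) μ → (∀ p : E3, μ {p} ≠ 0 → ∀ y : E3, (∀ q : E3, μ {q} ≠ 0 → q ≠ p → y ≠ q) →
        ∑' q : {q : E3 // μ {q} ≠ 0 ∧ q ≠ p}, lennardJones (dist p (q : E3)) ≤ ∑' q : {q : E3 // μ {q} ≠ 0 ∧ q ≠ p}, lennardJones (dist y (q : E3))) →
      μ ∈ K i → eStar + mK i ≤ rootEnergy lennardJones μ)
    {m : ℝ} (hm0 : 0 < m) (hm : ∀ i < n, m ≤ mK i) {η : ℝ} (hη : η ≤ reach m 5) : CoherentMassExclusion n K η :=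
  coherentMassExclusion_of_floors n K hK mK hfloor hm0 (by norm_num) hm deficit_le_five hη

/-- hence the crux ⟸ the hfloor lines of a certified atlas with margin floor `m > 0` ∧ its off-atlas residual A(reach m 5). [new: junction] -/
theorem aperiodicFrustratedLawGap_of_offAtlasMassGap_sharp (n : ℕ) (K : ℕ → Set (MeasureTheory.Measure (EuclideanSpace ℝ (Fin 3))))
    (hK : ∀ i, MeasurableSet (K i)) (mK : ℕ → ℝ)
    (hfloor : ∀ i < n, ∀ μ : Measure E3, IsRootedHardCore (7 / 10) μ → (∀ p : E3, μ {p} ≠ 0 → ∀ y : E3, (∀ q : E3, μ {q} ≠ 0 → q ≠ p → y ≠ q) →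
        ∑' q : {q : E3 // μ {q} ≠ 0 ∧ q ≠ p}, lennardJones (dist p (q : E3)) ≤ ∑' q : {q : E3 // μ {q} ≠ 0 ∧ q ≠ p}, lennardJones (dist y (q : E3))) →
      μ ∈ K i → eStar + mK i ≤ rootEnergy lennardJones μ)
    {m : ℝ} (hm0 : 0 < m) (hm : ∀ i < n, m ≤ mK i) (hA : OffAtlasMassGap n K (reach m 5)) :
    Summit.AtomisticToContinuum.Crystallization.Theses.FrustratedLawDichotomy.AperiodicFrustratedLawGap :=
  aperiodicFrustratedLawGap_of_massSplit n K _ (coherentMassExclusion_sharp n K hK mK hfloor hm0 hm le_rfl) hA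

/-- THE NUMBER: with the class-A margin of record `m_A(F1) = 5057/10⁶` the sharp cap reaches `> 1/1000` of law mass — more than `35 ×` the
reach `< 1/30000` of the tree cap `D_univ ≈ 177.04` ((404) `reach_F1_univ`). [new: numerical instance] -/
theorem reach_F1_sharp : 1 / 1000 < reach (5057 / 1000000) 5 ∧ 35 * reach (5057 / 1000000) Duniv < reach (5057 / 1000000) 5 := by
  unfold reach Duniv; constructor <;> norm_num

end Summit.AtomisticToContinuum.Crystallization.Theorems.FrustratedLawDichotomySharpDeficitCap

end
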